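import Mathlib
import Summits.KontsevichZagierPeriods.KontsevichZagierPeriods.Theorems.InverseLandauTateFamilyKernelTameCertificate
import Summits.KontsevichZagierPeriods.KontsevichZagierPeriods.Theorems.InverseLandauTateFamilyKernelOpenCube

/-!
# `TateLifting` (stmt-KontsevichZagierPeriods-9129), line `Sketch` — stub `stub_dimZeroLift`

DIMENSION-ZERO LIFT. A KZ-rational integral representation `r` of dimension `0` differs by
relations of the Kontsevich–Zagier calculus from a KZ-rational representation `ρ` of dimension `1`.

The space `ℝ⁰ = (Fin 0 → ℝ)` is one point, so `r.domain` is either empty or the whole space.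

* Empty domain: `[r]` is a relation (null domain, `KZ.of_mem_relations_of_volume_eq_zero`), and we
  take for `ρ` the zero representation `[(0,1), 0/1]`, itself a relation
  (`KZ.of_mem_relations_of_eqOn_zero`).
* Full domain: `r.IsRational` gives `p q ∈ ℚ[∅]` with `q(pt) ≠ 0` and `r.integrand pt = c := p(pt)/q(pt)`.
  Reading `p, q` as polynomials in one variable (`MvPolynomial.rename Fin.elim0`) gives the honest
  KZ-rational representation `ρ = [(0,1), c]` with the SAME constant integrand. The difference
  `[r] − [ρ]` is a relation through the tame closed cubes `[[0,1]⁰, c]` and `[[0,1]¹, c]`: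
  congruence on `ℝ⁰ = [0,1]⁰` (`KZ.of_sub_of_mem_relations_of_eqOn`), ignoring the last coordinate
  of a tame cube (`TateFamilyKernel.tame_liftLast`, one Newton–Leibniz move with primitive `c·t`),
  and closed versus open unit interval (`TateFamilyKernel.of_sub_of_mem_relations_of_domain_eq_cube`,
  the two end points are null).

References: M. Kontsevich, D. Zagier, *Periods* (2001), §1.2, rules (1) and (3).
-/

noncomputable section

open MeasureTheory Set MvPolynomial
open Literature.ModelTheory.ExponentialFields (IsSemialgebraic)
open Literature.NumberTheory.Transcendental

namespace Summit.KontsevichZagierPeriods.InverseLandau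

namespace DimOne

/-! ### Dimension-zero helpers (`dz_`) -/

/-- A polynomial in zero variables, read as a polynomial in one variable through
`MvPolynomial.rename Fin.elim0`, evaluates at every point of `ℝ¹` to its value at the point `ℝ⁰`.
[folklore] -/
theorem dz_aeval_rename (p : MvPolynomial (Fin 0) ℚ) (x : Fin 1 → ℝ) :
    aeval x (rename Fin.elim0 p) = aeval (default : Fin 0 → ℝ) p := by
  rw [aeval_rename]
  exact congrArg (fun g => aeval g p) (Subsingleton.elim _ _)

/-- The open unit interval `(0,1) ⊆ ℝ¹`, spelled `Set.pi univ (0,1)`, is `ℚ`-semialgebraic.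
[folklore] -/
theorem dz_isSemialgebraic_pi_Ioo :
    IsSemialgebraic ℚ (Set.pi Set.univ fun _ : Fin 1 => Set.Ioo (0 : ℝ) 1) := by
  rw [TateFamilyKernel.pi_univ_Ioo_eq_openUnitCube]
  exact isSemialgebraic_openUnitCube

/-- The open unit interval `(0,1) ⊆ ℝ¹` lies in the closed unit cube `[0,1]¹`. [folklore] -/
theorem dz_pi_Ioo_subset_cube :
    (Set.pi Set.univ fun _ : Fin 1 => Set.Ioo (0 : ℝ) 1) ⊆ KZ.cube 1 := by
  rw [TateFamilyKernel.pi_univ_Ioo_eq_openUnitCube]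
  exact KZ.openUnitCube_subset_cube

/-- A constant function is real-analytic near every closed unit cube. [folklore] -/
theorem dz_analyticOnNhd_const {n : ℕ} (c : ℝ) :
    AnalyticOnNhd ℝ (fun _ : Fin n → ℝ => c) (KZ.cube n) :=
  fun _ _ => analyticAt_const

/-- **Empty domain.** A representation of dimension `0` whose domain misses the point of `ℝ⁰` has
empty, hence null, domain and is a relation. [cite: KontsevichZagier2001, §1.2] -/
theorem dz_of_mem_relations_of_not_mem (r : KZ.IntegralRep 0) (h : (default : Fin 0 → ℝ) ∉ r.domain) :
    KZ.of r ∈ KZ.relations := by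
  have hdom : r.domain = ∅ :=
    Set.eq_empty_of_forall_notMem fun x hx => h ((Subsingleton.elim x default) ▸ hx)
  exact KZ.of_mem_relations_of_volume_eq_zero r (by rw [hdom, measure_empty])

/-- **The zero representation `[(0,1), 0/1]`** of dimension `1`: KZ-rational and a relation.
[cite: KontsevichZagier2001, §1.2] -/
theorem dz_exists_zero_isRational :
    ∃ ρ : KZ.IntegralRep 1, ρ.IsRational ∧ KZ.of ρ ∈ KZ.relations := by
  have hq : ∀ x ∈ (Set.pi Set.univ fun _ : Fin 1 => Set.Ioo (0 : ℝ) 1),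
      aeval x (1 : MvPolynomial (Fin 1) ℚ) ≠ 0 := fun x _ => by simp
  have hint : IntegrableOn (fun x : Fin 1 → ℝ =>
      aeval x (0 : MvPolynomial (Fin 1) ℚ) / aeval x (1 : MvPolynomial (Fin 1) ℚ))
      (Set.pi Set.univ fun _ : Fin 1 => Set.Ioo (0 : ℝ) 1) := by
    simp
  refine ⟨KZ.IntegralRep.ofRational _ 0 1 dz_isSemialgebraic_pi_Ioo hq hint,
    KZ.IntegralRep.isRational_ofRational _ 0 1 dz_isSemialgebraic_pi_Ioo hq hint,
    KZ.of_mem_relations_of_eqOn_zero _ fun x _ => ?_⟩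
  simp

/-- **Full domain.** If the domain of a KZ-rational representation `r` of dimension `0` contains the
point of `ℝ⁰`, then `r` differs by relations from the honest KZ-rational representation `[(0,1), c]`
of dimension `1` with the same constant integrand `c = p(pt)/q(pt)` (tame lift along the last
coordinate, then closed versus open interval). [cite: KontsevichZagier2001, §1.2] -/
theorem dz_exists_isRational_of_mem (r : KZ.IntegralRep 0) (hr : r.IsRational)
    (h0 : (default : Fin 0 → ℝ) ∈ r.domain) :
    ∃ ρ : KZ.IntegralRep 1, ρ.IsRational ∧ KZ.of r - KZ.of ρ ∈ KZ.relations := by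
  obtain ⟨p, q, hq, hpq⟩ := hr
  have hdom : r.domain = Set.univ :=
    Set.eq_univ_of_forall fun x => (Subsingleton.elim default x) ▸ h0
  -- the constant value
  set c : ℝ := aeval (default : Fin 0 → ℝ) p / aeval (default : Fin 0 → ℝ) q with hc
  have hrc : ∀ x : Fin 0 → ℝ, r.integrand x = c := fun x => by
    rw [Subsingleton.elim x default]
    exact hpq h0
  -- the same polynomials in one variable
  have hPQ : (fun x : Fin 1 → ℝ => aeval x (rename Fin.elim0 p) / aeval x (rename Fin.elim0 q)) =
      fun _ => c := funext fun x => by rw [dz_aeval_rename, dz_aeval_rename]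
  have hQ : ∀ x ∈ (Set.pi Set.univ fun _ : Fin 1 => Set.Ioo (0 : ℝ) 1),
      aeval x (rename Fin.elim0 q) ≠ 0 := fun x _ => by
    rw [dz_aeval_rename]
    exact hq _ h0
  have hQ' : ∀ x ∈ KZ.cube 1, aeval x (rename Fin.elim0 q) ≠ 0 := fun x _ => by
    rw [dz_aeval_rename]
    exact hq _ h0
  -- the two tame cubes `[[0,1]¹, c]` and `[[0,1]⁰, c]`
  have hUs : IsSemialgebraicFunOn ℚ (KZ.cube 1) (fun _ : Fin 1 → ℝ => c) := by
    have h := isSemialgebraicFunOn_aeval_div_aeval KZ.isSemialgebraic_cube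
      (rename Fin.elim0 p) (rename Fin.elim0 q) hQ'
    rwa [hPQ] at h
  have hus : IsSemialgebraicFunOn ℚ (KZ.cube 0) (fun _ : Fin 0 → ℝ => c) :=
    (isSemialgebraicFunOn_aeval_div_aeval KZ.isSemialgebraic_cube p q fun x _ => by
      rw [Subsingleton.elim x default]; exact hq _ h0).congr fun x _ => by
        change aeval x p / aeval x q = c
        rw [Subsingleton.elim x default]
  set U : KZ.IntegralRep 1 := KZ.IntegralRep.tameCube (fun _ : Fin 1 → ℝ => c)
    (dz_analyticOnNhd_const c) hUs with hU
  set u0 : KZ.IntegralRep 0 := KZ.IntegralRep.tameCube (fun _ : Fin 0 → ℝ => c)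
    (dz_analyticOnNhd_const c) hus with hu0
  -- the honest representation `ρ = [(0,1), c]`
  have hint : IntegrableOn
      (fun x : Fin 1 → ℝ => aeval x (rename Fin.elim0 p) / aeval x (rename Fin.elim0 q))
      (Set.pi Set.univ fun _ : Fin 1 => Set.Ioo (0 : ℝ) 1) := by
    rw [hPQ]
    exact (KZ.IntegralRep.isTameCube_tameCube _ (dz_analyticOnNhd_const (n := 1) c)
      hUs).integrableOn.mono_set dz_pi_Ioo_subset_cube
  set ρ : KZ.IntegralRep 1 := KZ.IntegralRep.ofRational _ (rename Fin.elim0 p) (rename Fin.elim0 q)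
    dz_isSemialgebraic_pi_Ioo hQ hint with hρ
  refine ⟨ρ, KZ.IntegralRep.isRational_ofRational _ _ _ dz_isSemialgebraic_pi_Ioo hQ hint, ?_⟩
  -- the three relations
  have h1 : KZ.of U - KZ.of u0 ∈ KZ.relations :=
    TateFamilyKernel.tame_liftLast (dz_analyticOnNhd_const c) hus U
      (KZ.IntegralRep.isTameCube_tameCube _ _ _) (fun _ _ => rfl) u0
      (KZ.IntegralRep.isTameCube_tameCube _ _ _) (fun _ _ => rfl)
  have h2 : KZ.of r - KZ.of u0 ∈ KZ.relations :=
    KZ.of_sub_of_mem_relations_of_eqOn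
      (by rw [hdom, hu0, KZ.IntegralRep.tameCube_domain, KZ.cube_zero]) fun x _ => hrc x
  have h3 : KZ.of U - KZ.of ρ ∈ KZ.relations :=
    TateFamilyKernel.of_sub_of_mem_relations_of_domain_eq_cube U ρ rfl rfl fun x _ => by
      rw [hρ, KZ.IntegralRep.integrand_ofRational, hU, KZ.IntegralRep.tameCube_integrand, hPQ]
  have : KZ.of r - KZ.of ρ = (KZ.of r - KZ.of u0) - (KZ.of U - KZ.of u0) + (KZ.of U - KZ.of ρ) := by
    abel
  rw [this]
  exact KZ.relations.add_mem (KZ.relations.sub_mem h2 h1) h3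

end DimOne

/-- **Dimension-zero lift** (stub `stub_dimZeroLift` of the lead's skeleton, the body of
`DimZeroLift`): a KZ-rational representation of dimension `0` — a rational constant over the point
`ℝ⁰`, or the empty domain — differs by relations of the Kontsevich–Zagier calculus from a KZ-rational
representation of dimension `1` (`[(0,1), c]`: congruence over the point, one Newton–Leibniz move
lifting the constant to the closed unit interval, and the two null end points; for the empty domain
both `[r]` and the zero representation `[(0,1), 0]` are relations).
[cite: KontsevichZagier2001, §1.2] -/
theorem tateLifting_dimZeroLift :
    ∀ r : KZ.IntegralRep 0, r.IsRational →
      ∃ ρ : KZ.IntegralRep 1, ρ.IsRational ∧ KZ.of r - KZ.of ρ ∈ KZ.relations := by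
  intro r hr
  by_cases h0 : (default : Fin 0 → ℝ) ∈ r.domain
  · exact DimOne.dz_exists_isRational_of_mem r hr h0
  · obtain ⟨ρ, hρ, hρrel⟩ := DimOne.dz_exists_zero_isRational
    exact ⟨ρ, hρ, KZ.relations.sub_mem (DimOne.dz_of_mem_relations_of_not_mem r h0) hρrel⟩

end Summit.KontsevichZagierPeriods.InverseLandau

end
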